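import Summits.HodgeConjecture.HodgeConjecture.Theorems.R90S2ArchLocalWeilFamilies      -- ★ FILE 3b (mine): `archLocTorusMeasure`, `archLocWeilFamily` (+ `_atPoint`), `exists_pi_eq_map_archCentralizerPiEquiv`, `map_archQuotPiEquiv_eq`
import HarnessLib

/-!
# R90-TF ∕ S2 «Ch. 12 archimedean block» — `R90S2ArchProductFamilyOfQuotient`: the PRODUCT clause of ★ CARD 3 `isArchStablyNull_of_place` from T2's measure
# convention (W)(C) (orbital-product road FILE 3c — the last link of the L-Π chain ★ FILE 1 → ★ FILE 2 → ★ CARD 3)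

Cell `pub/hodgecm-mathlib`, HCML Track R90-TF, section S2 (base `R90-C11`), crux h413 = `stmt-HodgeConjecture-24833`, route of record `HCCMUnconditional`; prover seat
LH4-p05 (g11) (S2 desk K2E1b-plan (g8) deal 2026-09-05T02:23:15Z (4), census «=» 02:38:26Z); lane `--kind proof --supports stmt-HodgeConjecture-24833 --as helper`
(theorems only).  Conventions of ★ FILE 1: no socket, no instance, no notation, no `sorry`; ONE measured `maxHeartbeats` on the transport chain.

## WHAT
T2's `ArchTransfersExistCanonical` binds the archimedean orbital-measure family `mG` of `G_∞ = U(H)(L ⊗ ℝ)` by (W) «`mG [γ] = dν ∕ dt_{out [γ]}` at regular classes»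
(★ `OrbitalMeasureFamily.IsQuotientOf`) and (C) «`t` is transported along ★ `archStableCentralizerEquiv` under stable conjugacy».  ★ CARD 3
`isArchStablyNull_of_place` wants, for every regular `γ`, local families `mLoc` with ★ FILE 1's `IsArchProductFamily H (· ∼st γ) mG mLoc`.  This file PRODUCES them
(the local Weil families of ★ FILE 3b):
* `map_archQuotPiEquiv_quotientMeasure_eq_pi` — **for `γ₀ ↔ γ`: `(dν ∕ dt_{γ₀})` in the coordinates `archQuotPiEquiv γ₀` IS `⊗_w (archLocWeilFamily w).atPoint (γ₀)_w`**:
  (C) + ★ FILE 3a «the global transport is the product of the local ones» give `(t γ₀) ≅ ⊗_w τ_w((γ₀)_w)` along `Z(γ₀) ≅ ∏ Z((γ₀)_w)` (Mathlib `Measure.pi_map_pi`); then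
  ★ `map_cosetCongr_quotientMeasure` (naturality along `e`, with `ν ≅ ⊗ νw`) and ★ `map_quotientPiHomeomorph_quotientMeasure_pi` («quotient of the products = product of
  the quotients», exact), and ★ FILE 3b `archLocWeilFamily_atPoint`.
* `isArchProductFamily_archLocWeilFamily` — (W) at the class representatives + the previous + ★ FILE 2 `isArchProductFamily_of_map_out_pi` ⟹
  `IsArchProductFamily H (· ∼st γ) mG (w ↦ archLocWeilFamily …)`.
* `exists_isArchProductFamily_of_isQuotientOf` — THE PACKAGED HEAD: T2's (W)(C) VERBATIM + `ν ≅ ⊗ νw` (★ CARD 6 `exists_pi_eq_map_archPiEquivCM` gives `νw` for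
  any Haar `ν`) + `γ` regular ⟹ `∃ mLoc, IsArchProductFamily H (· ∼st γ) mG mLoc` ∧ admissibility of every member ∧ per place the local WEIL-FORM certificate with
  (C_w)-coherent torus measures and junk `0` off the local stable class (the handle of the later local stable-vanishing payer, ℓ4 ∕ ℓT2-E (E2)).

HONEST LABEL: measure-theoretic plumbing; pays NO printed input (it turns T2's (W)(C) binders into ★ CARD 3's `hu` product clause; the local vanishing conjunct
stays a letter); HC_CM is proved only modulo the 7 printed citations (2 remaining named inputs: hLiu418 = `stmt-HodgeConjecture-24832`, h413 =
`stmt-HodgeConjecture-24833`) until rung 0 closes.  Count-neutral.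

References: [Rogawski1990] §1.7 p. 6, §4.3 (4.3.1) pp. 43–44, §5.4 p. 72; [Shelstad1979] §4 p. 20; [LanglandsShelstad1987] §1.3–1.4; [DeitmarEchterhoff2014] Thm. 1.5.3;
[Folland1995] §2.6 Thm. 2.49.
-/

set_option autoImplicit false
set_option linter.dupNamespace false  -- the route namespace `Summit.HodgeConjecture.HodgeConjecture.…` repeats a component by design (as ★ FILE 1)

noncomputable section

open MeasureTheory NumberField NumberField.InfinitePlace
open scoped Matrix MatrixGroups Classical
open Literature.NumberTheory.Automorphic Literature.NumberTheory.Automorphic.UnitaryGroup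
open Literature.NumberTheory.Rogawski1990
open Literature.LinearAlgebra.Matrix
open Literature.MeasureTheory.Group

namespace Summit.HodgeConjecture.HodgeConjecture.R90.S2

/-! ## §7 The product clause of ★ CARD 3 from T2's (W)(C) -/

section Product

variable {L : Type} [Field L] [NumberField L] [IsCMField L] {N : ℕ} (H : Matrix (Fin N) (Fin N) L) (hH : H.det ≠ 0)
  [MeasurableSpace ↥(arch (↥(maximalRealSubfield L)) L (IsCMField.complexConj L) N H)]
  [BorelSpace ↥(arch (↥(maximalRealSubfield L)) L (IsCMField.complexConj L) N H)]
  [∀ γ : ↥(arch (↥(maximalRealSubfield L)) L (IsCMField.complexConj L) N H),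
    MeasurableSpace (↥(arch (↥(maximalRealSubfield L)) L (IsCMField.complexConj L) N H) ⧸ Subgroup.centralizer ({γ} : Set _))]
  [∀ γ : ↥(arch (↥(maximalRealSubfield L)) L (IsCMField.complexConj L) N H),
    BorelSpace (↥(arch (↥(maximalRealSubfield L)) L (IsCMField.complexConj L) N H) ⧸ Subgroup.centralizer ({γ} : Set _))]
  [∀ w : {w : InfinitePlace L // w.IsComplex}, MeasurableSpace ↥(archLocal L N H w)]
  [∀ w : {w : InfinitePlace L // w.IsComplex}, BorelSpace ↥(archLocal L N H w)]
  [∀ (w : {w : InfinitePlace L // w.IsComplex}) (δ : ↥(archLocal L N H w)),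
    MeasurableSpace (↥(archLocal L N H w) ⧸ Subgroup.centralizer ({δ} : Set ↥(archLocal L N H w)))]
  [∀ (w : {w : InfinitePlace L // w.IsComplex}) (δ : ↥(archLocal L N H w)),
    BorelSpace (↥(archLocal L N H w) ⧸ Subgroup.centralizer ({δ} : Set ↥(archLocal L N H w)))]

set_option maxHeartbeats 400000 in  -- measured: the transport chain below exceeds the default 200000 (long subgroup/coercion types)
/-- **THE QUOTIENT MEASURE AT A STABLE CONJUGATE IN PRODUCT COORDINATES.**  For `γ` regular with `(t γ) ≅ ⊗_w τ⁰_w` along `Z(γ) ≅ ∏_w Z(γ_w)`, (C)-coherent `t`,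
`ν ≅ ⊗ νw` along `e`, and any `γ₀ ↔ γ` (stably conjugate) at which `t γ₀` is Haar and inversion-invariant:
`(dν ∕ dt_{γ₀})` read through `archQuotPiEquiv γ₀` IS `⊗_w (archLocWeilFamily w).atPoint (γ₀)_w` — (C) + ★ FILE 3a give `(t γ₀) ≅ ⊗_w τ_w((γ₀)_w)`
(`Measure.pi_map_pi`), then ★ `map_cosetCongr_quotientMeasure` (naturality along `e`) and ★ `map_quotientPiHomeomorph_quotientMeasure_pi` (quotient of products = product
of quotients), and the local Weil families read at the points `(γ₀)_w` (§5).
[cite: Rogawski1990, §1.7 p. 6; §4.3 (4.3.1) p. 43] [cite: DeitmarEchterhoff2014, Thm. 1.5.3] [cite: Folland1995, §2.6 Thm. 2.49] -/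
theorem map_archQuotPiEquiv_quotientMeasure_eq_pi
    (ν : Measure ↥(arch (↥(maximalRealSubfield L)) L (IsCMField.complexConj L) N H)) [ν.IsHaarMeasure] [ν.IsMulRightInvariant]
    {t : ∀ γ : ↥(arch (↥(maximalRealSubfield L)) L (IsCMField.complexConj L) N H), Measure (Subgroup.centralizer ({γ} : Set _))}
    (hC : ∀ (γ₁ γ₂ : ↥(arch (↥(maximalRealSubfield L)) L (IsCMField.complexConj L) N H))
        (h₁ : IsRegularElt (γ₁.val : GL (Fin N) (mixedEmbedding.mixedSpace L)))
        (hc : Corresponds (conjMixed (↥(maximalRealSubfield L)) L (IsCMField.complexConj L)) (archFormOf L N H) (archFormOf L N H) γ₁ γ₂),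
        Measure.map (archStableCentralizerEquiv L hH hH hc h₁) (t γ₁) = t γ₂)
    (νw : ∀ w : {w : InfinitePlace L // w.IsComplex}, Measure ↥(archLocal L N H w)) [∀ w, (νw w).IsHaarMeasure] [∀ w, (νw w).IsMulRightInvariant]
    (hν : ν.map ⇑(archPiEquivCM L H (N := N)) = Measure.pi νw)
    (γ : ↥(arch (↥(maximalRealSubfield L)) L (IsCMField.complexConj L) N H)) (hγ : IsRegularElt (γ.val : GL (Fin N) (mixedEmbedding.mixedSpace L)))
    (τ₀ : ∀ w : {w : InfinitePlace L // w.IsComplex}, Measure (Subgroup.centralizer ({archPiEquivCM L H (N := N) γ w} : Set ↥(archLocal L N H w))))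
    [∀ w, (τ₀ w).IsHaarMeasure] (hτ₀ : (t γ).map (archCentralizerPiEquiv H γ) = Measure.pi τ₀)
    (γ₀ : ↥(arch (↥(maximalRealSubfield L)) L (IsCMField.complexConj L) N H))
    (hc : Corresponds (conjMixed (↥(maximalRealSubfield L)) L (IsCMField.complexConj L)) (archFormOf L N H) (archFormOf L N H) γ γ₀)
    [ht₁ : (t γ₀).IsHaarMeasure] [ht₂ : (t γ₀).IsInvInvariant] :
    (quotientMeasure (Subgroup.centralizer ({γ₀} : Set _)) (t γ₀) (isClosed_coe_centralizer_singleton γ₀) ν).map (archQuotPiEquiv H γ₀) =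
      Measure.pi fun w : {w : InfinitePlace L // w.IsComplex} =>
        (archLocWeilFamily H hH (isRegularElt_archPiEquivCM H γ hγ w) (τ₀ w) (νw w)).atPoint (archPiEquivCM L H (N := N) γ₀ w) := by
  classical
  -- instances on the factors and their tori
  haveI : ∀ w : {w : InfinitePlace L // w.IsComplex}, SecondCountableTopology ↥(archLocal L N H w) := fun w =>
    secondCountableTopology_archLocal L N H w
  haveI : ∀ w : {w : InfinitePlace L // w.IsComplex}, LocallyCompactSpace ↥(archLocal L N H w) := fun w =>
    locallyCompactSpace_archLocal L N H w
  haveI : ∀ w : {w : InfinitePlace L // w.IsComplex},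
      LocallyCompactSpace (Subgroup.centralizer ({archPiEquivCM L H (N := N) γ₀ w} : Set ↥(archLocal L N H w))) := fun w =>
    (isClosed_coe_centralizer_singleton _).isClosedEmbedding_subtypeVal.locallyCompactSpace
  haveI : ∀ w : {w : InfinitePlace L // w.IsComplex},
      SecondCountableTopology (Subgroup.centralizer ({archPiEquivCM L H (N := N) γ₀ w} : Set ↥(archLocal L N H w))) := fun w =>
    TopologicalSpace.Subtype.secondCountableTopology _
  -- the local components of `γ₀` lie in the local stable classes of the `γ_w`
  have hst : ∀ w : {w : InfinitePlace L // w.IsComplex},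
      IsStablyConj (starRingEnd ℂ) (H.map w.1.embedding) (archPiEquivCM L H (N := N) γ w) (archPiEquivCM L H (N := N) γ₀ w) :=
    fun w => isStablyConj_archPiEquivCM H hc w
  -- the local torus measures at the components of `γ₀`
  set ρi : ∀ w : {w : InfinitePlace L // w.IsComplex},
      Measure (Subgroup.centralizer ({archPiEquivCM L H (N := N) γ₀ w} : Set ↥(archLocal L N H w))) :=
    fun w => archLocTorusMeasure H hH (isRegularElt_archPiEquivCM H γ hγ w) (τ₀ w) (archPiEquivCM L H (N := N) γ₀ w) with hρidef
  haveI hρi₁ : ∀ w, (ρi w).IsHaarMeasure := fun w => isHaarMeasure_archLocTorusMeasure H hH _ (τ₀ w) (hst w)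
  haveI hρi₂ : ∀ w, (ρi w).IsInvInvariant := fun w => isInvInvariant_archLocTorusMeasure H hH _ (τ₀ w) (hst w)
  -- the local Weil families read at the components: `dνw ∕ dρi w`
  have hloc : ∀ w : {w : InfinitePlace L // w.IsComplex},
      (archLocWeilFamily H hH (isRegularElt_archPiEquivCM H γ hγ w) (τ₀ w) (νw w)).atPoint (archPiEquivCM L H (N := N) γ₀ w) =
        quotientMeasure (Subgroup.centralizer ({archPiEquivCM L H (N := N) γ₀ w} : Set _)) (ρi w)
          (isClosed_coe_centralizer_singleton _) (νw w) := by
    intro w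
    obtain ⟨_, _, h⟩ := archLocWeilFamily_atPoint H hH (isRegularElt_archPiEquivCM H γ hγ w) (τ₀ w) (νw w) _ (hst w)
    exact h
  -- (C): `t γ₀ = ψ_* t γ`; ★ FILE 3a: in product coordinates `t γ₀` is `⊗_w ρi w`
  have htγ₀ : (t γ₀).map (archCentralizerPiEquiv H γ₀) = Measure.pi ρi := by
    haveI : ∀ w : {w : InfinitePlace L // w.IsComplex}, SigmaFinite ((τ₀ w).map
        ⇑(archLocalStableCentralizerEquiv H hH (isStablyConj_archPiEquivCM H hc w) (isRegularElt_archPiEquivCM H γ hγ w))) := fun w => by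
      haveI := ContinuousMulEquiv.isHaarMeasure_map (τ₀ w)
        (archLocalStableCentralizerEquiv H hH (isStablyConj_archPiEquivCM H hc w) (isRegularElt_archPiEquivCM H γ hγ w))
      infer_instance
    have hmA : Measurable ⇑(archCentralizerPiEquiv H γ₀) := (archCentralizerPiEquiv H γ₀).continuous.measurable
    have hmB : Measurable ⇑(archStableCentralizerEquiv L hH hH hc hγ) := (archStableCentralizerEquiv L hH hH hc hγ).continuous.measurable
    have hmC : Measurable ⇑(archCentralizerPiEquiv H γ) := (archCentralizerPiEquiv H γ).continuous.measurable
    have hmw : ∀ w : {w : InfinitePlace L // w.IsComplex},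
        Measurable ⇑(archLocalStableCentralizerEquiv H hH (isStablyConj_archPiEquivCM H hc w) (isRegularElt_archPiEquivCM H γ hγ w)) := fun w =>
      (archLocalStableCentralizerEquiv H hH (isStablyConj_archPiEquivCM H hc w) (isRegularElt_archPiEquivCM H γ hγ w)).continuous.measurable
    have hmD : Measurable (fun (p : ∀ w : {w : InfinitePlace L // w.IsComplex},
          Subgroup.centralizer ({archPiEquivCM L H (N := N) γ w} : Set ↥(archLocal L N H w))) (w : {w : InfinitePlace L // w.IsComplex}) =>
        archLocalStableCentralizerEquiv H hH (isStablyConj_archPiEquivCM H hc w) (isRegularElt_archPiEquivCM H γ hγ w) (p w)) :=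
      measurable_pi_iff.mpr fun w => (hmw w).comp (measurable_pi_apply w)
    rw [← hC γ γ₀ hγ hc, Measure.map_map hmA hmB, archCentralizerPiEquiv_comp_archStableCentralizerEquiv H hH hc hγ,
      ← Measure.map_map hmD hmC, hτ₀, Measure.pi_map_pi (fun w => (hmw w).aemeasurable)]
    refine congrArg Measure.pi (funext fun w => ?_)
    rw [hρidef]
    exact (archLocTorusMeasure_eq_map H hH _ (τ₀ w) (hst w)).symm
  -- Borel structure on the quotient of the product by the product of the tori
  letI : MeasurableSpace ((∀ w : {w : InfinitePlace L // w.IsComplex}, ↥(archLocal L N H w)) ⧸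
      Subgroup.pi Set.univ (fun w : {w : InfinitePlace L // w.IsComplex} =>
        Subgroup.centralizer ({archPiEquivCM L H (N := N) γ₀ w} : Set ↥(archLocal L N H w)))) := borel _
  haveI : BorelSpace ((∀ w : {w : InfinitePlace L // w.IsComplex}, ↥(archLocal L N H w)) ⧸
      Subgroup.pi Set.univ (fun w : {w : InfinitePlace L // w.IsComplex} =>
        Subgroup.centralizer ({archPiEquivCM L H (N := N) γ₀ w} : Set ↥(archLocal L N H w)))) := ⟨rfl⟩
  have hZw : ∀ w : {w : InfinitePlace L // w.IsComplex},
      IsClosed ((Subgroup.centralizer ({archPiEquivCM L H (N := N) γ₀ w} : Set ↥(archLocal L N H w)) : Subgroup _) : Set ↥(archLocal L N H w)) :=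
    fun w => isClosed_coe_centralizer_singleton _
  haveI hZpi : IsClosed ((Subgroup.pi Set.univ (fun w : {w : InfinitePlace L // w.IsComplex} =>
      Subgroup.centralizer ({archPiEquivCM L H (N := N) γ₀ w} : Set ↥(archLocal L N H w))) :
        Subgroup (∀ w : {w : InfinitePlace L // w.IsComplex}, ↥(archLocal L N H w))) :
      Set (∀ w : {w : InfinitePlace L // w.IsComplex}, ↥(archLocal L N H w))) :=
    isClosed_coe_pi _ hZw
  haveI hZγ₀ : IsClosed ((Subgroup.centralizer ({γ₀} : Set ↥(arch (↥(maximalRealSubfield L)) L (IsCMField.complexConj L) N H)) :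
      Subgroup ↥(arch (↥(maximalRealSubfield L)) L (IsCMField.complexConj L) N H)) :
        Set ↥(arch (↥(maximalRealSubfield L)) L (IsCMField.complexConj L) N H)) :=
    isClosed_coe_centralizer_singleton γ₀
  -- the torus measure transported to `∏_w Z((γ₀)_w) ≤ ∏_w U(σ_w H)(ℂ)`
  set ρ' : Measure ↥(Subgroup.pi Set.univ (fun w : {w : InfinitePlace L // w.IsComplex} =>
      Subgroup.centralizer ({archPiEquivCM L H (N := N) γ₀ w} : Set ↥(archLocal L N H w)))) :=
    (t γ₀).map (subgroupCongrHomeomorph (archPiEquivCM L H (N := N)).toMulEquiv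
      (Subgroup.centralizer ({γ₀} : Set ↥(arch (↥(maximalRealSubfield L)) L (IsCMField.complexConj L) N H)))
      (Subgroup.pi Set.univ (fun w : {w : InfinitePlace L // w.IsComplex} =>
        Subgroup.centralizer ({archPiEquivCM L H (N := N) γ₀ w} : Set ↥(archLocal L N H w))))
      (archPiEquivCM_mem_pi_centralizer_iff H γ₀) (archPiEquivCM L H (N := N)).continuous (archPiEquivCM L H (N := N)).symm.continuous) with hρ'def
  have hρ'pi : ρ'.map (subgroupPiCoords (fun w : {w : InfinitePlace L // w.IsComplex} =>
      Subgroup.centralizer ({archPiEquivCM L H (N := N) γ₀ w} : Set ↥(archLocal L N H w)))) = Measure.pi ρi := by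
    have hm5 : Measurable ⇑(subgroupPiCoords (fun w : {w : InfinitePlace L // w.IsComplex} =>
        Subgroup.centralizer ({archPiEquivCM L H (N := N) γ₀ w} : Set ↥(archLocal L N H w)))) :=
      (subgroupPiHomeomorph (fun w : {w : InfinitePlace L // w.IsComplex} =>
        Subgroup.centralizer ({archPiEquivCM L H (N := N) γ₀ w} : Set ↥(archLocal L N H w)))).continuous.measurable
    have hm6 : Measurable ⇑(subgroupCongrHomeomorph (archPiEquivCM L H (N := N)).toMulEquiv
      (Subgroup.centralizer ({γ₀} : Set ↥(arch (↥(maximalRealSubfield L)) L (IsCMField.complexConj L) N H)))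
      (Subgroup.pi Set.univ (fun w : {w : InfinitePlace L // w.IsComplex} =>
        Subgroup.centralizer ({archPiEquivCM L H (N := N) γ₀ w} : Set ↥(archLocal L N H w))))
      (archPiEquivCM_mem_pi_centralizer_iff H γ₀) (archPiEquivCM L H (N := N)).continuous (archPiEquivCM L H (N := N)).symm.continuous) :=
      (Homeomorph.continuous _).measurable
    rw [hρ'def, Measure.map_map hm5 hm6]
    exact htγ₀
  -- `ρ'` is the pull-back of `⊗ ρi` along the topological-group isomorphism `subgroupPiCoords`, hence Haar and inversion-invariant
  set eZ : ↥(Subgroup.pi Set.univ (fun w : {w : InfinitePlace L // w.IsComplex} =>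
        Subgroup.centralizer ({archPiEquivCM L H (N := N) γ₀ w} : Set ↥(archLocal L N H w)))) ≃ₜ*
      (∀ w : {w : InfinitePlace L // w.IsComplex}, Subgroup.centralizer ({archPiEquivCM L H (N := N) γ₀ w} : Set ↥(archLocal L N H w))) :=
    { subgroupPiCoords (fun w : {w : InfinitePlace L // w.IsComplex} =>
        Subgroup.centralizer ({archPiEquivCM L H (N := N) γ₀ w} : Set ↥(archLocal L N H w))) with
      continuous_toFun := (subgroupPiHomeomorph _).continuous
      continuous_invFun := (subgroupPiHomeomorph _).symm.continuous } with heZdef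
  have hmZ : Measurable ⇑eZ := eZ.continuous.measurable
  have hmZs : Measurable ⇑eZ.symm := eZ.symm.continuous.measurable
  have hρ'eq : ρ' = (Measure.pi ρi).map eZ.symm := by
    have h1 : (ρ'.map eZ).map eZ.symm = ρ' := by
      rw [Measure.map_map hmZs hmZ]
      have : (⇑eZ.symm ∘ ⇑eZ) = id := funext fun x => eZ.symm_apply_apply x
      rw [this, Measure.map_id]
    rw [← h1]
    exact congrArg _ hρ'pi
  haveI : ρ'.IsHaarMeasure := by
    rw [hρ'eq]; exact ContinuousMulEquiv.isHaarMeasure_map _ _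
  haveI : ρ'.IsInvInvariant := by
    rw [hρ'eq]
    refine ⟨?_⟩
    rw [Measure.inv, Measure.map_map measurable_inv hmZs,
      show (Inv.inv ∘ ⇑eZ.symm) = (⇑eZ.symm ∘ Inv.inv) from funext fun x => (map_inv eZ.symm x).symm,
      ← Measure.map_map hmZs measurable_inv]
    congr 1
    exact Measure.inv_eq_self _
  -- Step A: naturality of the quotient measure along `e`
  have hA := map_cosetCongr_quotientMeasure (archPiEquivCM L H (N := N)).toMulEquiv (archPiEquivCM L H (N := N)).continuous
    (archPiEquivCM L H (N := N)).symm.continuous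
    (Subgroup.centralizer ({γ₀} : Set ↥(arch (↥(maximalRealSubfield L)) L (IsCMField.complexConj L) N H)))
    (Subgroup.pi Set.univ (fun w : {w : InfinitePlace L // w.IsComplex} =>
      Subgroup.centralizer ({archPiEquivCM L H (N := N) γ₀ w} : Set ↥(archLocal L N H w))))
    (archPiEquivCM_mem_pi_centralizer_iff H γ₀) (t γ₀) ρ' ν (Measure.pi νw) hρ'def (by exact hν.symm)
  -- Step B: the quotient of the products is the product of the quotients
  have hB := map_quotientPiHomeomorph_quotientMeasure_pi
    (fun w : {w : InfinitePlace L // w.IsComplex} => Subgroup.centralizer ({archPiEquivCM L H (N := N) γ₀ w} : Set ↥(archLocal L N H w)))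
    hZw ρi ρ' hρ'pi νw
  rw [map_archQuotPiEquiv_eq H γ₀, hA, hB]
  exact congrArg Measure.pi (funext fun w => (hloc w).symm)

/-- **THE PRODUCT CLAUSE FROM (W)(C)** — the remaining link of the L-Π chain ★ FILE 1 → ★ FILE 2 → ★ CARD 3.  Let the archimedean family `mG` on
`G_∞ = U(H)(L ⊗ ℝ)` be in WEIL FORM for `(ν, t)` on the regular classes ((W), ★ `OrbitalMeasureFamily.IsQuotientOf` — T2's `ArchTransfersExistCanonical`
conjunct VERBATIM) with torus measures `t` COHERENT under stable conjugacy ((C) VERBATIM), and let `ν` factor over the complex places as `⊗ νw` along ★ `archPiEquivCM`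
(★ CARD 6 `exists_pi_eq_map_archPiEquivCM`).  Fix a regular `γ` and a product decomposition `(t γ) ≅ ⊗_w τ⁰_w` along `Z(γ) ≅ ∏_w Z(γ_w)`
(`exists_pi_eq_map_archCentralizerPiEquiv`).  Then the LOCAL WEIL FAMILIES `archLocWeilFamily` of the `U(σ_w H)(ℂ)` for `(νw, τ_w)` — `τ_w` the transport of `τ⁰_w`
from `γ_w` along the local stable class (§5) — are tied to `mG` on the whole STABLE CLASS of `γ`:
`IsArchProductFamily H (· ∼st γ) mG (fun w => archLocWeilFamily …)`, i.e. `Φ([γ'], ⊗ φ_w) = ∏_w Φ([γ'_w], φ_w)` for every `γ' ∼st γ` and every pure tensor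
(Rogawski §5.4 p. 72 at the archimedean places, with print's compatible measures §1.7 ∕ §4.3): at `c = [γ']` the representative `γ₀ := out c ∼st γ` is regular,
(W) gives `mG c = dν∕dt_{γ₀}`, and `map_archQuotPiEquiv_quotientMeasure_eq_pi` + ★ FILE 2 `isArchProductFamily_of_map_out_pi` conclude.
[cite: Rogawski1990, §5.4 p. 72; §1.7 p. 6; §4.3 (4.3.1) p. 43] [cite: DeitmarEchterhoff2014, Thm. 1.5.3] [cite: Folland1995, §2.6 Thm. 2.49] -/
theorem isArchProductFamily_archLocWeilFamily
    {ν : Measure ↥(arch (↥(maximalRealSubfield L)) L (IsCMField.complexConj L) N H)} [ν.IsHaarMeasure] [ν.IsMulRightInvariant]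
    {t : ∀ γ : ↥(arch (↥(maximalRealSubfield L)) L (IsCMField.complexConj L) N H), Measure (Subgroup.centralizer ({γ} : Set _))}
    {mG : OrbitalMeasureFamily ↥(arch (↥(maximalRealSubfield L)) L (IsCMField.complexConj L) N H)}
    (hW : mG.IsQuotientOf (fun γ => IsRegularElt (γ.val : GL (Fin N) (mixedEmbedding.mixedSpace L))) ν t)
    (hC : ∀ (γ₁ γ₂ : ↥(arch (↥(maximalRealSubfield L)) L (IsCMField.complexConj L) N H))
        (h₁ : IsRegularElt (γ₁.val : GL (Fin N) (mixedEmbedding.mixedSpace L)))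
        (hc : Corresponds (conjMixed (↥(maximalRealSubfield L)) L (IsCMField.complexConj L)) (archFormOf L N H) (archFormOf L N H) γ₁ γ₂),
        Measure.map (archStableCentralizerEquiv L hH hH hc h₁) (t γ₁) = t γ₂)
    (νw : ∀ w : {w : InfinitePlace L // w.IsComplex}, Measure ↥(archLocal L N H w)) [∀ w, (νw w).IsHaarMeasure] [∀ w, (νw w).IsMulRightInvariant]
    (hν : ν.map ⇑(archPiEquivCM L H (N := N)) = Measure.pi νw)
    (γ : ↥(arch (↥(maximalRealSubfield L)) L (IsCMField.complexConj L) N H)) (hγ : IsRegularElt (γ.val : GL (Fin N) (mixedEmbedding.mixedSpace L)))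
    (τ₀ : ∀ w : {w : InfinitePlace L // w.IsComplex}, Measure (Subgroup.centralizer ({archPiEquivCM L H (N := N) γ w} : Set ↥(archLocal L N H w))))
    [∀ w, (τ₀ w).IsHaarMeasure] (hτ₀ : (t γ).map (archCentralizerPiEquiv H γ) = Measure.pi τ₀) :
    IsArchProductFamily H
      (fun γ' : ↥(arch (↥(maximalRealSubfield L)) L (IsCMField.complexConj L) N H) =>
        IsStablyConj (conjMixed (↥(maximalRealSubfield L)) L (IsCMField.complexConj L)) (archFormOf L N H) γ' γ) mG
      (fun w => archLocWeilFamily H hH (isRegularElt_archPiEquivCM H γ hγ w) (τ₀ w) (νw w)) := by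
  haveI : ∀ (w : {w : InfinitePlace L // w.IsComplex}) (c : ConjClasses ↥(archLocal L N H w)),
      SMulInvariantMeasure ↥(archLocal L N H w) _ (archLocWeilFamily H hH (isRegularElt_archPiEquivCM H γ hγ w) (τ₀ w) (νw w) c) :=
    fun w c => smulInvariantMeasure_archLocWeilFamily H hH _ _ _ c
  haveI : ∀ (w : {w : InfinitePlace L // w.IsComplex}) (c : ConjClasses ↥(archLocal L N H w)),
      IsFiniteMeasureOnCompacts (archLocWeilFamily H hH (isRegularElt_archPiEquivCM H γ hγ w) (τ₀ w) (νw w) c) :=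
    fun w c => isFiniteMeasureOnCompacts_archLocWeilFamily H hH _ _ _ c
  refine isArchProductFamily_of_map_out_pi H (fun γ' hγ' => ?_)
  -- the representative `out [γ']` is conjugate to `γ'`, hence corresponds to `γ` and is regular
  have hconj : IsConj γ' (Quotient.out (ConjClasses.mk γ')) :=
    ConjClasses.mk_eq_mk_iff_isConj.mp (Quotient.out_eq (ConjClasses.mk γ')).symm
  have hc : Corresponds (conjMixed (↥(maximalRealSubfield L)) L (IsCMField.complexConj L)) (archFormOf L N H) (archFormOf L N H) γ
      (Quotient.out (ConjClasses.mk γ')) :=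
    (IsConj.symm hγ').trans ((arch (↥(maximalRealSubfield L)) L (IsCMField.complexConj L) N H).subtype.map_isConj hconj)
  have hreg : IsRegularElt ((Quotient.out (ConjClasses.mk γ') : ↥(arch (↥(maximalRealSubfield L)) L (IsCMField.complexConj L) N H)).val :
      GL (Fin N) (mixedEmbedding.mixedSpace L)) := isRegularElt_of_isConj hc hγ
  -- (W) at the class: `mG [γ'] = dν ∕ dt_{out [γ']}`
  obtain ⟨ht₁, ht₂, hmG⟩ := hW (ConjClasses.mk γ') hreg
  rw [hmG]
  exact map_archQuotPiEquiv_quotientMeasure_eq_pi H hH ν hC νw hν γ hγ τ₀ hτ₀ _ hc (ht₁ := ht₁) (ht₂ := ht₂)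

/-- **THE PACKAGED HEAD — the product clause of ★ CARD 3 `isArchStablyNull_of_place`'s `hu`, from T2's (W)(C) VERBATIM.**  For `mG` in Weil form for `(ν, t)` on
the regular classes ((W)) with (C)-coherent torus measures, `ν ≅ ⊗ νw` along ★ `archPiEquivCM` (★ CARD 6 `exists_pi_eq_map_archPiEquivCM` produces `νw` for any
Haar `ν`), and every REGULAR `γ ∈ G_∞`: THERE ARE local orbital-measure families `mLoc w` on the `U(σ_w H)(ℂ)` — the local Weil families `archLocWeilFamily` of §5 —
with (i) `IsArchProductFamily H (· ∼st γ) mG mLoc` (★ FILE 1's binder on the whole stable class of `γ`: `Φ([γ'], ⊗ φ_w) = ∏_w Φ([γ'_w], φ_w)`); (ii) admissibility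
of EVERY member (invariant, finite on compacta — ★ FILE 2 MAIN's binders); (iii) the LOCAL WEIL-FORM CERTIFICATE `(mLoc w).IsQuotientOf (γ_w ∼st ·) (νw w) τ` for local
torus measures `τ` that are (C_w)-COHERENT under conjugation and junk `0` off the local stable class of `γ_w` — the handle for the local stable-vanishing payer (ℓ4 ∕
ℓT2-E (E2)), whose statement is about the SUM over a local stable class and survives the one uniform rescaling hidden in `τ⁰_{w}`.  The topological instance binders
on the factors are ★ `locallyCompactSpace_archLocal` ∕ ★ `secondCountableTopology_archLocal` (supplied by consumers with `haveI`).
[cite: Rogawski1990, §5.4 p. 72; §1.7 p. 6; §4.3 (4.3.1) p. 43] [cite: Shelstad1979, §4 p. 20] [cite: DeitmarEchterhoff2014, Thm. 1.5.3] -/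
theorem exists_isArchProductFamily_of_isQuotientOf
    [∀ w : {w : InfinitePlace L // w.IsComplex}, LocallyCompactSpace ↥(archLocal L N H w)]
    [∀ w : {w : InfinitePlace L // w.IsComplex}, SecondCountableTopology ↥(archLocal L N H w)]
    {ν : Measure ↥(arch (↥(maximalRealSubfield L)) L (IsCMField.complexConj L) N H)} [ν.IsHaarMeasure] [ν.IsMulRightInvariant]
    {t : ∀ γ : ↥(arch (↥(maximalRealSubfield L)) L (IsCMField.complexConj L) N H), Measure (Subgroup.centralizer ({γ} : Set _))}
    {mG : OrbitalMeasureFamily ↥(arch (↥(maximalRealSubfield L)) L (IsCMField.complexConj L) N H)}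
    (hW : mG.IsQuotientOf (fun γ => IsRegularElt (γ.val : GL (Fin N) (mixedEmbedding.mixedSpace L))) ν t)
    (hC : ∀ (γ₁ γ₂ : ↥(arch (↥(maximalRealSubfield L)) L (IsCMField.complexConj L) N H))
        (h₁ : IsRegularElt (γ₁.val : GL (Fin N) (mixedEmbedding.mixedSpace L)))
        (hc : Corresponds (conjMixed (↥(maximalRealSubfield L)) L (IsCMField.complexConj L)) (archFormOf L N H) (archFormOf L N H) γ₁ γ₂),
        Measure.map (archStableCentralizerEquiv L hH hH hc h₁) (t γ₁) = t γ₂)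
    (νw : ∀ w : {w : InfinitePlace L // w.IsComplex}, Measure ↥(archLocal L N H w)) [∀ w, (νw w).IsHaarMeasure] [∀ w, (νw w).IsMulRightInvariant]
    (hν : ν.map ⇑(archPiEquivCM L H (N := N)) = Measure.pi νw)
    (γ : ↥(arch (↥(maximalRealSubfield L)) L (IsCMField.complexConj L) N H)) (hγ : IsRegularElt (γ.val : GL (Fin N) (mixedEmbedding.mixedSpace L))) :
    ∃ mLoc : ∀ w : {w : InfinitePlace L // w.IsComplex}, OrbitalMeasureFamily ↥(archLocal L N H w),
      IsArchProductFamily H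
          (fun γ' : ↥(arch (↥(maximalRealSubfield L)) L (IsCMField.complexConj L) N H) =>
            IsStablyConj (conjMixed (↥(maximalRealSubfield L)) L (IsCMField.complexConj L)) (archFormOf L N H) γ' γ) mG mLoc ∧
        (∀ (w : {w : InfinitePlace L // w.IsComplex}) (c : ConjClasses ↥(archLocal L N H w)), SMulInvariantMeasure ↥(archLocal L N H w) _ (mLoc w c)) ∧
        (∀ (w : {w : InfinitePlace L // w.IsComplex}) (c : ConjClasses ↥(archLocal L N H w)), IsFiniteMeasureOnCompacts (mLoc w c)) ∧
        ∀ w : {w : InfinitePlace L // w.IsComplex},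
          ∃ τ : ∀ δ : ↥(archLocal L N H w), Measure (Subgroup.centralizer ({δ} : Set ↥(archLocal L N H w))),
            (mLoc w).IsQuotientOf
                (fun δ : ↥(archLocal L N H w) => IsStablyConj (starRingEnd ℂ) (H.map w.1.embedding) (archPiEquivCM L H (N := N) γ w) δ) (νw w) τ ∧
              (∀ (δ₁ δ₂ q : ↥(archLocal L N H w)) (hq : (MulAut.conj q : _ ≃* ↥(archLocal L N H w)) δ₁ = δ₂),
                  IsStablyConj (starRingEnd ℂ) (H.map w.1.embedding) (archPiEquivCM L H (N := N) γ w) δ₁ →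
                    Measure.map (subgroupCongrHomeomorph (MulAut.conj q : _ ≃* ↥(archLocal L N H w)) (Subgroup.centralizer ({δ₁} : Set _))
                      (Subgroup.centralizer ({δ₂} : Set _)) (forall_apply_mem_centralizer_singleton_iff_of_eq (MulAut.conj q : _ ≃* _) hq)
                      (continuous_mulAutConj q) (continuous_mulAutConj_symm q)) (τ δ₁) = τ δ₂) ∧
              (∀ c : ConjClasses ↥(archLocal L N H w),
                  ¬ IsStablyConj (starRingEnd ℂ) (H.map w.1.embedding) (archPiEquivCM L H (N := N) γ w) (Quotient.out c) → mLoc w c = 0) := by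
  -- (W)+(C) at the regular point `γ`: `t γ` is a Haar measure (★ `atPoint_eq_quotientMeasure_of_isQuotientOf_of_archCoherent`)
  obtain ⟨htγ, -, -⟩ := atPoint_eq_quotientMeasure_of_isQuotientOf_of_archCoherent L hH hW hC γ hγ
  -- a product decomposition of `t γ` along `Z(γ) ≅ ∏_w Z(γ_w)`
  obtain ⟨τ₀, hτ₀H, hτ₀⟩ := exists_pi_eq_map_archCentralizerPiEquiv H γ (t γ)
  haveI : ∀ w, (τ₀ w).IsHaarMeasure := hτ₀H
  refine ⟨fun w => archLocWeilFamily H hH (isRegularElt_archPiEquivCM H γ hγ w) (τ₀ w) (νw w),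
    isArchProductFamily_archLocWeilFamily H hH hW hC νw hν γ hγ τ₀ hτ₀,
    fun w c => smulInvariantMeasure_archLocWeilFamily H hH _ _ _ c,
    fun w c => isFiniteMeasureOnCompacts_archLocWeilFamily H hH _ _ _ c,
    fun w => ⟨archLocTorusMeasure H hH (isRegularElt_archPiEquivCM H γ hγ w) (τ₀ w),
      archLocWeilFamily_isQuotientOf H hH _ _ _,
      fun δ₁ δ₂ q hq h₁ => map_subgroupCongrHomeomorph_conj_archLocTorusMeasure H hH _ _ δ₁ δ₂ q hq h₁,
      fun c hc => archLocWeilFamily_of_not H hH _ _ _ c hc⟩⟩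

end Product

end Summit.HodgeConjecture.HodgeConjecture.R90.S2

end
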